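import Summits.QuantumFields.YangMills.Theorems.LuscherReductionTwistedTraceScalingBOSupportGeometry
import Summits.QuantumFields.YangMills.Theorems.LuscherReductionTwistedTraceScalingSliceSmooth
import Summits.QuantumFields.YangMills.Theorems.LuscherReductionTwistedTraceScalingTangentChart
import Summits.QuantumFields.YangMills.Theorems.LuscherReductionTwistedTraceScalingGaugeActionRelLinkVec
import Summits.QuantumFields.YangMills.Theorems.FemtoTransferGapRungW1up
import Mathlib.Analysis.Quaternion
import HarnessLib

/-!
# (S1) THE SLOW SHADOW: a configuration linkwise `ρ`-close to `1` and `δ`-close to a pure gauge has slow mean within `O(δ/L³ + L(ρ+δ)²)` of the one-site vacuum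
# (lane A of S-BASE, crux `TwistedTraceScaling` stmt-QuantumFields-20203, C4 INNER; design note `pub/ym-fleet/ym-luscher-20007-p1/COARSE-DESIGN.md` §24.8)

The one structural field of `RecordBOInput` that is not bookkeeping (`hshadow`).  If `U ∈ nearOne ρ` and `orbitDist U < δ` then `U = W + O(δ)` linkwise (in `ℓ¹`) for the PURE GAUGE
`W_e = g(x)⁻¹g(x+k)`, whose links are within `ρ + δ` of `1`; the comb transporter `G(x) = treeGauge W x` (`…RunningReductionTreeGauge/CombGaugeBox`) has `W_{(x,k)} = G(x)⁻¹G(x+k)`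
and `‖G(x) − 1‖_F ≤ 3L(ρ+δ)`; the KEY IDENTITY (in the quaternions) `Σ_x (q(x)⁻¹q(x+k) − 1) = Σ_x (q(x)⁻¹ − 1)(q(x+k) − q(x))` (the telescoping sum vanishes by the shift bijection)
bounds the direction sum `Σ_x W_{(x,k)}` within `3L⁴(ρ+δ)²` of `L³·1`; normalising (`polarMean`) and `orbitDist_one_site_eq` finish.
* quaternion bookkeeping (`card_edge_one` is `…FemtoTransferGap.card_edge_one`) `su2Quat_inv'`, `norm_su2Quat_sub_le`, `frobNorm_sub_one_le_two_norm`, `pureGauge_sum_identity`, `norm_pureGauge_sum_le`, `norm_normalize_sub_one_le`;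
* `gaugeTransform_inv_gaugeTransform`, `lineProd_one_cfg`, `treeGauge_one_cfg`;
* ★★★ `orbitDist_slowMean_le` — `orbitDist (slowMean U) ≤ 12·(δ + 3L⁴(ρ+δ)²)/L³`.
HONEST FRAMING: structural geometry for a stub of a child of the CONDITIONAL reduction route R2b1; analytic bricks OPEN; C4 OPEN; not a gap, not Clay.
-/

set_option autoImplicit false

noncomputable section

open MeasureTheory Filter Topology Real
open scoped BigOperators Quaternion
open Literature.MathematicalPhysics.QuantumFieldTheory
open Literature.MathematicalPhysics.QuantumLattice
open Literature.MathematicalPhysics.QuantumFieldTheory.Balaban1983to89.T4HaarSU2Translate (su2Quat_quatToSU2 su2Quat_one)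

namespace Summit.QuantumFields.YangMills.Theorems.FemtoTransferGap.TwoLattice.ConstTube

open Summit.QuantumFields.YangMills.Theorems.FemtoTransferGap

variable {L : ℕ} [NeZero L]

/-! ## §1 Quaternion bookkeeping -/

/-- `su2Quat W⁻¹ = (su2Quat W)⁻¹`. [folklore] -/
theorem su2Quat_inv' (W : SU2) : su2Quat W⁻¹ = (su2Quat W)⁻¹ := by
  have h : su2Quat W * su2Quat W⁻¹ = 1 := by rw [← Balaban1983to89.T4HaarSU2Translate.su2Quat_mul, mul_inv_cancel, su2Quat_one]
  have hne : su2Quat W ≠ 0 := fun h0 => by rw [h0, zero_mul] at h; exact zero_ne_one h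
  calc su2Quat W⁻¹ = (su2Quat W)⁻¹ * (su2Quat W * su2Quat W⁻¹) := by rw [← mul_assoc, inv_mul_cancel₀ hne, one_mul]
    _ = (su2Quat W)⁻¹ := by rw [h, mul_one]

/-- `‖su2Quat U − su2Quat V‖² = ‖U − V‖_F²/2`. [cite: MontvayMunster1994, §3.2.3 (3.97)] -/
theorem norm_su2Quat_sub_sq (U V : SU2) :
    ‖su2Quat U - su2Quat V‖ ^ 2 = frobNorm ((U : Matrix (Fin 2) (Fin 2) ℂ) - (V : Matrix (Fin 2) (Fin 2) ℂ)) ^ 2 / 2 := by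
  rw [TwoLattice.Chart.frobNorm_sub_sq_eq, sq, ← Quaternion.normSq_eq_norm_mul_self, Quaternion.normSq_def']
  simp only [Quaternion.re_sub, Quaternion.imI_sub, Quaternion.imJ_sub, Quaternion.imK_sub, scalarPart, vecPart, Fin.sum_univ_three,
    Matrix.cons_val_zero, Matrix.cons_val_one, Matrix.cons_val]
  ring

/-- `‖su2Quat U − su2Quat V‖ ≤ ‖U − V‖_F`. [folklore] -/
theorem norm_su2Quat_sub_le (U V : SU2) : ‖su2Quat U - su2Quat V‖ ≤ frobNorm ((U : Matrix (Fin 2) (Fin 2) ℂ) - (V : Matrix (Fin 2) (Fin 2) ℂ)) := by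
  have h := norm_su2Quat_sub_sq U V
  have hF := frobNorm_nonneg ((U : Matrix (Fin 2) (Fin 2) ℂ) - (V : Matrix (Fin 2) (Fin 2) ℂ))
  nlinarith [norm_nonneg (su2Quat U - su2Quat V)]

/-- `‖U − 1‖_F ≤ 2‖su2Quat U − 1‖`. [folklore] -/
theorem frobNorm_sub_one_le_two_norm (U : SU2) : frobNorm ((U : Matrix (Fin 2) (Fin 2) ℂ) - 1) ≤ 2 * ‖su2Quat U - 1‖ := by
  have h := norm_su2Quat_sub_sq U 1
  rw [su2Quat_one, OneMemClass.coe_one] at h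
  have hF := frobNorm_nonneg ((U : Matrix (Fin 2) (Fin 2) ℂ) - 1)
  nlinarith [norm_nonneg (su2Quat U - 1)]

/-- The pure-gauge sum identity: `Σ_x (q(x)⁻¹ q(x+k) − 1) = Σ_x (q(x)⁻¹ − 1)(q(x+k) − q(x))` for nowhere-zero `q` (the telescoping sum vanishes on the torus). [folklore] -/
theorem pureGauge_sum_identity {q : Site 3 L → ℍ} (hq : ∀ x, q x ≠ 0) (k : Fin 3) :
    ∑ x : Site 3 L, ((q x)⁻¹ * q (x.shift k) - 1) = ∑ x : Site 3 L, ((q x)⁻¹ - 1) * (q (x.shift k) - q x) := by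
  have hpt : ∀ x : Site 3 L, ((q x)⁻¹ - 1) * (q (x.shift k) - q x) = ((q x)⁻¹ * q (x.shift k) - 1) - (q (x.shift k) - q x) := fun x => by
    have h1 := inv_mul_cancel₀ (hq x)
    rw [sub_mul, mul_sub, one_mul, h1]
  have htel : ∑ x : Site 3 L, (q (x.shift k) - q x) = 0 := by rw [Finset.sum_sub_distrib, sum_shift_eq L q k, sub_self]
  symm
  calc ∑ x : Site 3 L, ((q x)⁻¹ - 1) * (q (x.shift k) - q x) = ∑ x : Site 3 L, (((q x)⁻¹ * q (x.shift k) - 1) - (q (x.shift k) - q x)) :=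
        Finset.sum_congr rfl fun x _ => hpt x
    _ = ∑ x : Site 3 L, ((q x)⁻¹ * q (x.shift k) - 1) - ∑ x : Site 3 L, (q (x.shift k) - q x) := Finset.sum_sub_distrib _ _
    _ = _ := by rw [htel, sub_zero]

/-- Its consequence for UNIT quaternions: `‖Σ_x (q(x)⁻¹q(x+k) − 1)‖ ≤ Σ_x ‖q(x) − 1‖·‖q(x)⁻¹q(x+k) − 1‖`. [folklore] -/
theorem norm_pureGauge_sum_le {q : Site 3 L → ℍ} (hq : ∀ x, ‖q x‖ = 1) (k : Fin 3) :
    ‖∑ x : Site 3 L, ((q x)⁻¹ * q (x.shift k) - 1)‖ ≤ ∑ x : Site 3 L, ‖q x - 1‖ * ‖(q x)⁻¹ * q (x.shift k) - 1‖ := by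
  have hq0 : ∀ x, q x ≠ 0 := fun x h => by have := hq x; rw [h, norm_zero] at this; exact zero_ne_one this
  rw [pureGauge_sum_identity hq0 k]
  refine (norm_sum_le _ _).trans (Finset.sum_le_sum fun x _ => ?_)
  rw [norm_mul]
  have h1 : ‖(q x)⁻¹ - 1‖ = ‖q x - 1‖ := by
    have e : (q x)⁻¹ - 1 = (q x)⁻¹ * (1 - q x) := by rw [mul_sub, mul_one, inv_mul_cancel₀ (hq0 x)]
    rw [e, norm_mul, norm_inv, hq x, inv_one, one_mul, norm_sub_rev]
  have h2 : ‖q (x.shift k) - q x‖ = ‖(q x)⁻¹ * q (x.shift k) - 1‖ := by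
    have e : q (x.shift k) - q x = q x * ((q x)⁻¹ * q (x.shift k) - 1) := by
      rw [mul_sub, ← mul_assoc, mul_inv_cancel₀ (hq0 x), one_mul, mul_one]
    rw [e, norm_mul, hq x, one_mul]
  rw [h1, h2]

/-- Normalisation is `2/N`-Lipschitz at `N·1`: `‖‖D‖⁻¹•D − 1‖ ≤ 2‖D − N‖/N` (`D ≠ 0`, `N > 0`). [folklore] -/
theorem norm_normalize_sub_one_le {D : ℍ} (hD : D ≠ 0) {N : ℝ} (hN : 0 < N) : ‖‖D‖⁻¹ • D - 1‖ ≤ 2 * ‖D - (N : ℍ)‖ / N := by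
  have hDn : 0 < ‖D‖ := norm_pos_iff.mpr hD
  have hNq : ‖(N : ℍ)‖ = N := by rw [Quaternion.norm_coe, Real.norm_of_nonneg hN.le]
  -- `‖D/‖D‖ − D/N‖ = |1 − ‖D‖/N| ≤ ‖D − N‖/N`
  have h1 : ‖‖D‖⁻¹ • D - N⁻¹ • D‖ ≤ ‖D - (N : ℍ)‖ / N := by
    rw [← sub_smul, norm_smul, Real.norm_eq_abs]
    have e : |‖D‖⁻¹ - N⁻¹| * ‖D‖ = |N - ‖D‖| / N := by
      rw [show ‖D‖⁻¹ - N⁻¹ = (N - ‖D‖) / (‖D‖ * N) by field_simp, abs_div, abs_of_pos (mul_pos hDn hN)]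
      field_simp
    rw [e]
    refine div_le_div_of_nonneg_right ?_ hN.le
    have := abs_norm_sub_norm_le D (N : ℍ)
    rw [hNq] at this
    rw [abs_sub_comm]; exact this
  have h2 : ‖N⁻¹ • D - 1‖ = ‖D - (N : ℍ)‖ / N := by
    have e : N⁻¹ • D - 1 = N⁻¹ • (D - (N : ℍ)) := by
      rw [smul_sub, Quaternion.smul_coe, inv_mul_cancel₀ hN.ne', Quaternion.coe_one]
    rw [e, norm_smul, Real.norm_of_nonneg (inv_nonneg.mpr hN.le), inv_mul_eq_div]
  calc ‖‖D‖⁻¹ • D - 1‖ ≤ ‖‖D‖⁻¹ • D - N⁻¹ • D‖ + ‖N⁻¹ • D - 1‖ := by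
        have := norm_add_le (‖D‖⁻¹ • D - N⁻¹ • D) (N⁻¹ • D - 1); rwa [sub_add_sub_cancel] at this
    _ ≤ ‖D - (N : ℍ)‖ / N + ‖D - (N : ℍ)‖ / N := add_le_add h1 h2.le
    _ = 2 * ‖D - (N : ℍ)‖ / N := by ring

/-! ## §2 Gauge bookkeeping: the pure gauge and its comb transporter -/

omit [NeZero L] in
/-- `(U^g)^{g⁻¹} = U`. [folklore] -/
theorem gaugeTransform_inv_gaugeTransform (g : Site 3 L → SU2) (U : GaugeConfig 3 L SU2) :
    gaugeTransform (fun x => (g x)⁻¹) (gaugeTransform g U) = U := by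
  funext e; simp only [gaugeTransform]; group

omit [NeZero L] in
/-- Partial lines of the trivial configuration are trivial. [folklore] -/
theorem lineProd_one_cfg (x : Site 3 L) (k : Fin 3) : ∀ n : ℕ, lineProd (1 : GaugeConfig 3 L SU2) x k n = 1
  | 0 => rfl
  | n + 1 => by rw [lineProd_succ, lineProd_one_cfg x k n, Pi.one_apply, one_mul]

omit [NeZero L] in
/-- The comb transporter of the trivial configuration is trivial. [folklore] -/
theorem treeGauge_one_cfg (x : Site 3 L) : treeGauge (1 : GaugeConfig 3 L SU2) x = 1 := by
  unfold treeGauge; rw [lineProd_one_cfg, lineProd_one_cfg, lineProd_one_cfg, one_mul, one_mul]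

/-- `Σ_{e} f e ≥ Σ_x f (x, k)` for nonnegative `f` (the edges of one direction). [folklore] -/
theorem sum_dir_le_sum_edge {f : Edge 3 L → ℝ} (hf : ∀ e, 0 ≤ f e) (k : Fin 3) : ∑ x : Site 3 L, f (x, k) ≤ ∑ e : Edge 3 L, f e := by
  rw [Fintype.sum_prod_type]
  exact Finset.sum_le_sum fun x _ => Finset.single_le_sum (fun j _ => hf (x, j)) (Finset.mem_univ k)

/-! ## §3 ★★★ The slow shadow -/

/-- ★★★ **THE SLOW SHADOW (S1)**: if every link of `U` is within `ρ` of `1` and `orbitDist U < δ`, then with `N = L³` and `η = δ + 3·L·N·(ρ+δ)²`,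
`orbitDist (slowMean U) ≤ 12η/N` provided `η < N/2`.  (Comb gauge: the pure gauge `δ`-close to `U` has slow direction sums within `3LN(ρ+δ)²` of `N·1`.) [folklore] -/
theorem orbitDist_slowMean_le {U : GaugeConfig 3 L SU2} {ρ δ : ℝ} (hU : U ∈ nearOne L ρ) (hδ : orbitDist U < δ)
    (hsmall : δ + 3 * L * (Fintype.card (Site 3 L) : ℝ) * (ρ + δ) ^ 2 < (Fintype.card (Site 3 L) : ℝ) / 2) :
    orbitDist (slowMean L U) ≤ 12 * (δ + 3 * L * (Fintype.card (Site 3 L) : ℝ) * (ρ + δ) ^ 2) / Fintype.card (Site 3 L) := by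
  set N : ℝ := (Fintype.card (Site 3 L) : ℝ) with hNdef
  have hN : 0 < N := by rw [hNdef]; exact_mod_cast Fintype.card_pos
  set η : ℝ := δ + 3 * L * N * (ρ + δ) ^ 2 with hηdef
  -- a near-minimising gauge
  have hne : (Set.range fun g : Site 3 L → SU2 => gaugeDist g U).Nonempty := ⟨_, ⟨1, rfl⟩⟩
  have hδ' : sInf (Set.range fun g : Site 3 L → SU2 => gaugeDist g U) < δ := hδ
  obtain ⟨_, ⟨g, rfl⟩, hg⟩ := exists_lt_of_csInf_lt hne hδ'
  have hδ0 : 0 < δ := (orbitDist_nonneg U).trans_lt hδ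
  obtain ⟨e₀⟩ : Nonempty (Edge 3 L) := ⟨((fun _ => 0), 0)⟩
  have hρ0 : 0 < ρ := (frobNorm_nonneg _).trans_lt (hU e₀)
  set ρ' : ℝ := ρ + δ with hρ'
  have hρ'0 : 0 ≤ ρ' := by positivity
  -- the pure gauge `W` and `U = V^{g⁻¹}`
  set V : GaugeConfig 3 L SU2 := gaugeTransform g U with hVdef
  set h : Site 3 L → SU2 := fun x => (g x)⁻¹ with hh
  set W : GaugeConfig 3 L SU2 := gaugeTransform h (1 : GaugeConfig 3 L SU2) with hWdef
  have hUV : gaugeTransform h V = U := gaugeTransform_inv_gaugeTransform g U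
  have hUW : ∀ e : Edge 3 L, frobNorm (((U e : SU2) : Matrix (Fin 2) (Fin 2) ℂ) - ((W e : SU2) : Matrix (Fin 2) (Fin 2) ℂ)) =
      frobNorm (((V e : SU2) : Matrix (Fin 2) (Fin 2) ℂ) - 1) := fun e => by
    have h1 := frobNorm_gaugeTransform_sub h V 1 e
    rw [hUV] at h1
    rw [hWdef, h1, Pi.one_apply, OneMemClass.coe_one]
  have hVsum : ∑ e : Edge 3 L, frobNorm (((V e : SU2) : Matrix (Fin 2) (Fin 2) ℂ) - 1) < δ := hg
  have hVe : ∀ e : Edge 3 L, frobNorm (((V e : SU2) : Matrix (Fin 2) (Fin 2) ℂ) - 1) ≤ δ := fun e =>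
    (Finset.single_le_sum (fun e' _ => frobNorm_nonneg (((V e' : SU2) : Matrix (Fin 2) (Fin 2) ℂ) - 1)) (Finset.mem_univ e)).trans hVsum.le
  have hWnear : ∀ e : Edge 3 L, frobNorm (((W e : SU2) : Matrix (Fin 2) (Fin 2) ℂ) - 1) ≤ ρ' := fun e => by
    have e1 : ((W e : SU2) : Matrix (Fin 2) (Fin 2) ℂ) - 1 = (((U e : SU2) : Matrix (Fin 2) (Fin 2) ℂ) - 1) + -(((U e : SU2) : Matrix (Fin 2) (Fin 2) ℂ) - (W e : SU2)) := by
      abel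
    rw [e1]
    refine (frobNorm_add_le' _ _).trans ?_
    rw [frobNorm_neg, hUW e]
    exact add_le_add (hU e).le (hVe e)
  -- the comb transporter
  set G : Site 3 L → SU2 := fun x => treeGauge W x with hGdef
  have hG : ∀ x, G x = (g 0)⁻¹ * g x := fun x => by
    show treeGauge (gaugeTransform h 1) x = _
    rw [treeGauge_gaugeTransform, treeGauge_one_cfg, mul_one, hh]; simp
  have hWG : ∀ (x : Site 3 L) (k : Fin 3), W (x, k) = (G x)⁻¹ * G (x.shift k) := fun x k => by
    rw [hG, hG]
    show h x * (1 : GaugeConfig 3 L SU2) (x, k) * (h ((x, k).1.shift (x, k).2))⁻¹ = _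
    rw [Pi.one_apply, mul_one, hh]; group
  have hGnear : ∀ x, frobNorm (((G x : SU2) : Matrix (Fin 2) (Fin 2) ℂ) - 1) ≤ 3 * L * ρ' := fun x =>
    frobNorm_treeGauge_sub_one_le W hρ'0 (fun e _ => hWnear e) x
  -- quaternions
  set q : Site 3 L → ℍ := fun x => su2Quat (G x) with hqdef
  have hq1 : ∀ x, ‖q x‖ = 1 := fun x => norm_su2Quat (G x)
  have hqW : ∀ (x : Site 3 L) (k : Fin 3), su2Quat (W (x, k)) = (q x)⁻¹ * q (x.shift k) := fun x k => by
    rw [hWG, Balaban1983to89.T4HaarSU2Translate.su2Quat_mul, su2Quat_inv']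
  have hq_sub : ∀ x, ‖q x - 1‖ ≤ 3 * L * ρ' := fun x => by
    have := norm_su2Quat_sub_le (G x) 1
    rw [su2Quat_one, OneMemClass.coe_one] at this
    exact this.trans (hGnear x)
  have hw_sub : ∀ (x : Site 3 L) (k : Fin 3), ‖(q x)⁻¹ * q (x.shift k) - 1‖ ≤ ρ' := fun x k => by
    rw [← hqW]
    have := norm_su2Quat_sub_le (W (x, k)) 1
    rw [su2Quat_one, OneMemClass.coe_one] at this
    exact this.trans (hWnear (x, k))
  -- per direction: the direction sum is within `η` of `N`
  have hsumone : ∑ _x : Site 3 L, (1 : ℍ) = (N : ℍ) := by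
    rw [Finset.sum_const, Finset.card_univ, hNdef, Quaternion.coe_natCast]; simp
  have hdir : ∀ k : Fin 3, ‖dirQuat L k U - (N : ℍ)‖ ≤ η := fun k => by
    rw [dirQuat_eq_sum_su2Quat, ← hsumone, ← Finset.sum_sub_distrib]
    have hsplit : ∀ x : Site 3 L, su2Quat (U (x, k)) - 1 = (su2Quat (U (x, k)) - su2Quat (W (x, k))) + ((q x)⁻¹ * q (x.shift k) - 1) := fun x => by
      rw [← hqW]; abel
    rw [Finset.sum_congr rfl fun x _ => hsplit x, Finset.sum_add_distrib]
    refine (norm_add_le _ _).trans ?_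
    have h1 : ‖∑ x : Site 3 L, (su2Quat (U (x, k)) - su2Quat (W (x, k)))‖ ≤ δ := by
      refine (norm_sum_le _ _).trans ?_
      calc ∑ x : Site 3 L, ‖su2Quat (U (x, k)) - su2Quat (W (x, k))‖
          ≤ ∑ x : Site 3 L, frobNorm (((V (x, k) : SU2) : Matrix (Fin 2) (Fin 2) ℂ) - 1) :=
            Finset.sum_le_sum fun x _ => (norm_su2Quat_sub_le _ _).trans (le_of_eq (hUW (x, k)))
        _ ≤ ∑ e : Edge 3 L, frobNorm (((V e : SU2) : Matrix (Fin 2) (Fin 2) ℂ) - 1) :=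
            sum_dir_le_sum_edge (fun e => frobNorm_nonneg (((V e : SU2) : Matrix (Fin 2) (Fin 2) ℂ) - 1)) k
        _ ≤ δ := hVsum.le
    have h2 : ‖∑ x : Site 3 L, ((q x)⁻¹ * q (x.shift k) - 1)‖ ≤ 3 * L * N * ρ' ^ 2 := by
      refine (norm_pureGauge_sum_le hq1 k).trans ?_
      calc ∑ x : Site 3 L, ‖q x - 1‖ * ‖(q x)⁻¹ * q (x.shift k) - 1‖ ≤ ∑ _x : Site 3 L, (3 * L * ρ') * ρ' :=
            Finset.sum_le_sum fun x _ => mul_le_mul (hq_sub x) (hw_sub x k) (norm_nonneg _) (by positivity)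
        _ = 3 * L * N * ρ' ^ 2 := by rw [Finset.sum_const, Finset.card_univ, nsmul_eq_mul, ← hNdef]; ring
    rw [hηdef]; linarith
  -- per direction: the polar mean is within `4η/N` of `1`
  have hηN : η < N / 2 := hsmall
  have hpol : ∀ k : Fin 3, frobNorm (((polarMean L k U : SU2) : Matrix (Fin 2) (Fin 2) ℂ) - 1) ≤ 4 * η / N := fun k => by
    have hD : dirQuat L k U ≠ 0 := fun h0 => by
      have := hdir k
      rw [h0, zero_sub, norm_neg, Quaternion.norm_coe, Real.norm_of_nonneg hN.le] at this
      linarith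
    have hsq : su2Quat (polarMean L k U) = ‖dirQuat L k U‖⁻¹ • dirQuat L k U := by
      unfold polarMean; exact su2Quat_quatToSU2 hD
    have h1 := frobNorm_sub_one_le_two_norm (polarMean L k U)
    rw [hsq] at h1
    have h2 := norm_normalize_sub_one_le hD hN
    have h3 : 2 * ‖dirQuat L k U - (N : ℍ)‖ / N ≤ 2 * η / N := by
      refine div_le_div_of_nonneg_right ?_ hN.le; linarith [hdir k]
    calc frobNorm (((polarMean L k U : SU2) : Matrix (Fin 2) (Fin 2) ℂ) - 1) ≤ 2 * (2 * η / N) := h1.trans (by linarith)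
      _ = 4 * η / N := by ring
  -- sum over the three one-site edges
  rw [orbitDist_one_site_eq]
  calc ∑ e : Edge 3 1, frobNorm (((slowMean L U e : SU2) : Matrix (Fin 2) (Fin 2) ℂ) - 1) ≤ ∑ _e : Edge 3 1, 4 * η / N :=
        Finset.sum_le_sum fun e _ => hpol e.2
    _ = 12 * η / N := by rw [Finset.sum_const, Finset.card_univ, card_edge_one, nsmul_eq_mul]; push_cast; ring

end Summit.QuantumFields.YangMills.Theorems.FemtoTransferGap.TwoLattice.ConstTube

end
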